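import Literature.NumberTheory.GaloisRepresentations.SUnitsRestrictedLayers
import Literature.NumberTheory.GaloisRepresentations.SUnitsLayerInflation
import Literature.GroupTheory.ProfiniteSubquotients
import HarnessLib

/-!
# `Hⁿ(U, E_S)` read on the layers `Hⁿ(Gal(E/F₀), 𝒪_{E,S}ˣ)`: the transitions are the inflations, and
# `p`-divisibility / `p`-torsion-freeness of `Hⁿ(U, E_S)` follow from the LAYER SUPPLY statements
# (NSW (8.3.11) ⟹ the limit statements in the proof of (8.3.18))

Topic `NumberTheory/GaloisRepresentations`; namespace
`Literature.NumberTheory.GaloisRepresentations.SUnits.Layers`.  THEOREMS ONLY (no definition, no named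
fact, no `sorry`, no instance; D-0026).  Sequel of `SUnitsRestrictedLayers` ((A2-β2) part 1:
`layerCohomologyIso hHo E hF hS n : Hⁿ(↥U ⧸ V̄_E, (Res_U E_S)^{V̄_E}) ≅ Hⁿ(Gal(E/F₀), 𝒪_{E,S}ˣ)`),
`SUnitsLayerInflation` (`layerInf S hF hEE′ n`), `RestrictedRamificationOpenSubgroupLayers` ((A2-β1): the
layer subgroups `V̄_E` are cofinal, `exists_layerSubgroup_le`) and `Algebra/Homology/DiscreteRepLayerColimitDivisibility`
((A2-α): divisibility / torsion of `Hⁿ_cont` read on door-c4's layers).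

SETTING: `K` a number field, `S` a set of finite places, `H ≤ Γ_K` open with `N_S ≤ H`, `U := galoisGroupAbove S H`
(open in `G_{K,S}`), `F₀ := baseField H = K̄^H`, `E_S|_U := resRep K S H`.

* §1 **`stepG (V̄_E) (V̄_{E′}) ≫ iso_{E′} = iso_E ≫ layerInf S hF hEE′ n`** (`stepG_comp_layerCohomologyIso`): door-c4's
  transition between the layers of `E_S|_U` IS the inflation `Hⁿ(Gal(E/F₀), 𝒪_{E,S}ˣ) → Hⁿ(Gal(E′/F₀), 𝒪_{E′,S}ˣ)`
  (both are `groupCohomology.map` along `Gal(E′/F₀) → ↥U ⧸ V̄_E`, with underlying map `x ↦ x`);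
* §2 **discharge**: if every class `c ∈ Hⁿ(Gal(E/F₀), 𝒪_{E,S}ˣ)` (all finite Galois `E ⊇ F₀` inside `K_S`) becomes
  `p` times a class after inflation to some `E′ ⊇ E` (resp. every `c` with `p • c = 0` dies in some `E′`), then
  `p·` is onto `Hⁿ(U, E_S)` (resp. `Hⁿ(U, E_S)` has no `p`-torsion):
  `continuousCohomology_nsmul_surjective_of_layerSupply`, `continuousCohomology_eq_zero_of_nsmul_eq_zero_of_layerSupply`.

With `n = 2` (resp. `n = 3`) and the LAYER SUPPLY theorems (NSW (8.3.11) (iii)/(iv) at the finite layers) these are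
the inputs (iii) `H²(U, E_S)` `p`-divisible and (iv) `H³(U, E_S)[p] = 0` of the Kummer argument for `cd_p G_{K,S} ≤ 2`.
Lane «PT3-TC» of cell `bsd-eis` (crux `GoodLatticeBDPValue`, stmt-BirchSwinnertonDyer-19032; road memo `PT3TC-ROAD.md`,
brick (A2-β2), part 2).

## References
* J. Neukirch, A. Schmidt, K. Wingberg, *Cohomology of Number Fields*, 2nd ed. (2008), VIII §3, (1.5.1), proof of
  (8.3.18) via (8.3.11). [NeukirchSchmidtWingberg2008]
* J.-P. Serre, *Cohomologie galoisienne* (1994), I §2.2 Prop. 8. [SerreGaloisCohomology1997]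
* D. Harari, *Galois Cohomology and Class Field Theory* (2020), Prop. 4.18, Remark 4.24, §17.4. [Harari2020]
-/

noncomputable section

open NumberField IsDedekindDomain Field Topology CategoryTheory
open Literature.NumberTheory.GaloisRepresentations.IdeleClassBar (GalLayer)
open Literature.NumberTheory.GaloisRepresentations.LocalWeilDatum (galFixing mem_galFixing_iff)
open Literature.NumberTheory.IwasawaTheory.Greenberg2006 (galoisGroupAbove)
open Literature.NumberTheory.GaloisRepresentations.OpenSubgroupLayer (algOfLE isScalarTower_algOfLE baseField
  layerEquiv toAbove toAbove_surjective exists_layerSubgroup_le layerSubgroup_anti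
  ramificationSubgroup_le_galFixing_of_le coe_layerEquiv_mk_eq_of_le)
open Literature.Algebra.Homology Literature.Algebra.Homology.DiscreteRep
open Literature.Algebra.Homology.DiscreteRep.LayerColimit (stepG stepG_stepG)

namespace Literature.NumberTheory.GaloisRepresentations

namespace SUnits

namespace Layers

variable {K : Type} [Field K] [NumberField K] {S : Set (HeightOneSpectrum (𝓞 K))}
  {H : Subgroup (absoluteGaloisGroup K)}

/-! ### §1. The transitions are the inflations -/

/-- **The group homomorphisms agree**: `(↥U⧸V̄_{E′} → ↥U⧸V̄_E) ∘ layerEquiv_{E′}⁻¹ = layerEquiv_E⁻¹ ∘ (τ ↦ τ|_E)` as maps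
`Gal(E′/F₀) → ↥U ⧸ V̄_E` (both send `σ|_{E′}` to `[σ]`). [cite: SerreGaloisCohomology1997, I §2.2 Prop. 8] -/
theorem quotMap_comp_layerEquiv_symm (hHo : IsOpen (H : Set (absoluteGaloisGroup K))) {E E' : GalLayer K}
    (hEE' : E ≤ E') (hF : baseField H ≤ E.1) (hS' : ramificationSubgroup K S ≤ galFixing K E'.1) :
    letI := algOfLE hF
    letI := algOfLE (show E.1 ≤ E'.1 from hEE')
    letI := algOfLE (hF.trans hEE')
    haveI := E.isGalois
    haveI := normal_algOfLE (K := K) hF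
    haveI := isScalarTower_algOfLE₃ hF (show E.1 ≤ E'.1 from hEE')
    (quotMap ((OpenSubgroupLayer.layerSubgroup S hHo E hF (ramificationSubgroup_le_galFixing_of_le S hEE' hS') :
          OpenNormalSubgroup ↥(galoisGroupAbove S H)) : Subgroup ↥(galoisGroupAbove S H))
        ((OpenSubgroupLayer.layerSubgroup S hHo E' (hF.trans hEE') hS' : OpenNormalSubgroup ↥(galoisGroupAbove S H)) :
          Subgroup ↥(galoisGroupAbove S H))
        (layerSubgroup_anti S hHo hEE' hF hS')).comp
        (layerEquiv S hHo E' (hF.trans hEE') hS').symm.toMonoidHom =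
      (layerEquiv S hHo E hF (ramificationSubgroup_le_galFixing_of_le S hEE' hS')).symm.toMonoidHom.comp
        (AlgEquiv.restrictNormalHom (F := ↥(baseField H)) (K₁ := ↥E'.1) ↥E.1) := by
  letI := algOfLE hF
  letI := algOfLE (show E.1 ≤ E'.1 from hEE')
  letI := algOfLE (hF.trans hEE')
  haveI := E.isGalois
  haveI := normal_algOfLE (K := K) hF
  haveI := isScalarTower_algOfLE₃ hF (show E.1 ≤ E'.1 from hEE')
  refine MonoidHom.ext fun τ => ?_
  obtain ⟨q, rfl⟩ := (layerEquiv S hHo E' (hF.trans hEE') hS').surjective τ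
  induction q using QuotientGroup.induction_on with
  | H u =>
    rw [MonoidHom.comp_apply, MonoidHom.comp_apply, MulEquiv.coe_toMonoidHom, MulEquiv.coe_toMonoidHom,
      MulEquiv.symm_apply_apply, MulEquiv.eq_symm_apply]
    change layerEquiv S hHo E hF (ramificationSubgroup_le_galFixing_of_le S hEE' hS') (QuotientGroup.mk u) = _
    refine AlgEquiv.ext fun (x : ↥E.1) => Subtype.ext ?_
    rw [coe_layerEquiv_mk_eq_of_le S hHo hEE' hF hS' u x]
    exact (coe_restrictNormal_apply hF (show E.1 ≤ E'.1 from hEE') _ x).symm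

/-- **`stepG (V̄_E) (V̄_{E′}) ≫ iso_{E′} = iso_E ≫ layerInf S hF hEE′ n`**: door-c4's transition between the layers
`(E_S|_U)^{V̄_E} ⊆ (E_S|_U)^{V̄_{E′}}` is, under the layer isomorphisms of (A2-β2) part 1, the inflation
`Hⁿ(Gal(E/F₀), 𝒪_{E,S}ˣ) → Hⁿ(Gal(E′/F₀), 𝒪_{E′,S}ˣ)` of NSW's direct system.
[cite: SerreGaloisCohomology1997, I §2.2 Prop. 8] [cite: NeukirchSchmidtWingberg2008, VIII §3 (8.3.11)] -/
theorem stepG_comp_layerCohomologyIso (hHo : IsOpen (H : Set (absoluteGaloisGroup K))) {E E' : GalLayer K}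
    (hEE' : E ≤ E') (hF : baseField H ≤ E.1) (hS' : ramificationSubgroup K S ≤ galFixing K E'.1) (n : ℕ) :
    haveI := E.isGalois
    stepG (OpenSubgroupLayer.layerSubgroup S hHo E hF (ramificationSubgroup_le_galFixing_of_le S hEE' hS'))
        (OpenSubgroupLayer.layerSubgroup S hHo E' (hF.trans hEE') hS') (layerSubgroup_anti S hHo hEE' hF hS') (resD K S H hHo) n ≫
        (layerCohomologyIso hHo E' (hF.trans hEE') hS' n).hom =
      (layerCohomologyIso hHo E hF (ramificationSubgroup_le_galFixing_of_le S hEE' hS') n).hom ≫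
        layerInf S hF (show E.1 ≤ E'.1 from hEE') n := by
  letI := algOfLE hF
  letI := algOfLE (show E.1 ≤ E'.1 from hEE')
  letI := algOfLE (hF.trans hEE')
  haveI := E.isGalois
  haveI := normal_algOfLE (K := K) hF
  haveI := isScalarTower_algOfLE₃ hF (show E.1 ≤ E'.1 from hEE')
  rw [layerCohomologyIso, layerCohomologyIso, groupCohomology.mapIso_hom, groupCohomology.mapIso_hom, layerInf_eq_map,
    ← groupCohomology.map_comp, ← groupCohomology.map_comp]
  refine Literature.Algebra.Homology.map_congr' (quotMap_comp_layerEquiv_symm hHo hEE' hF hS') _ _ (fun z => ?_) n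
  change layerModuleEquiv hHo E' (hF.trans hEE') hS'
      ((invariantsStepIncl _ _ (layerSubgroup_anti S hHo hEE' hF hS') (resD K S H hHo)).hom z) =
    (layerInflHom S hF (show E.1 ≤ E'.1 from hEE')).hom
      (layerModuleEquiv hHo E hF (ramificationSubgroup_le_galFixing_of_le S hEE' hS') z)
  -- compare `K̄`-values (no `rw`: the motive would have to unify subtypes of `K̄` and of `E_S`)
  apply (Additive.toMul (α := sUnits K S ↥E'.1)).injective
  refine Subtype.ext (Units.ext (Subtype.ext ?_))
  refine (coe_layerModuleEquiv hHo E' (hF.trans hEE') hS' _).trans ?_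
  refine Eq.trans ?_ ((coe_layerInflHom S hF (show E.1 ≤ E'.1 from hEE') _).trans
    (coe_layerModuleEquiv hHo E hF (ramificationSubgroup_le_galFixing_of_le S hEE' hS') z)).symm
  rfl

/-- Elementwise form of the square. [cite: SerreGaloisCohomology1997, I §2.2 Prop. 8] -/
theorem layerCohomologyIso_hom_stepG (hHo : IsOpen (H : Set (absoluteGaloisGroup K))) {E E' : GalLayer K}
    (hEE' : E ≤ E') (hF : baseField H ≤ E.1) (hS' : ramificationSubgroup K S ≤ galFixing K E'.1) (n : ℕ)
    (c : groupCohomology (layerRep hHo E hF (ramificationSubgroup_le_galFixing_of_le S hEE' hS')) n) :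
    haveI := E.isGalois
    (layerCohomologyIso hHo E' (hF.trans hEE') hS' n).hom
        (stepG (OpenSubgroupLayer.layerSubgroup S hHo E hF (ramificationSubgroup_le_galFixing_of_le S hEE' hS'))
          (OpenSubgroupLayer.layerSubgroup S hHo E' (hF.trans hEE') hS') (layerSubgroup_anti S hHo hEE' hF hS') (resD K S H hHo) n c) =
      layerInf S hF (show E.1 ≤ E'.1 from hEE') n
        ((layerCohomologyIso hHo E hF (ramificationSubgroup_le_galFixing_of_le S hEE' hS') n).hom c) := by
  haveI := E.isGalois
  have h := congrArg (fun φ => φ c) (stepG_comp_layerCohomologyIso (S := S) hHo hEE' hF hS' n)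
  simpa only [ModuleCat.comp_apply] using h

/-! ### §2. Discharge: the LAYER SUPPLY statements give divisibility / torsion-freeness of `Hⁿ(U, E_S)` -/

/-- `U ≤ G_{K,S} = Γ_K ⧸ N_S` is totally disconnected (`N_S` closed). [cite: SerreGaloisCohomology1997, I §1.1] -/
theorem totallyDisconnectedSpace_above : TotallyDisconnectedSpace ↥(galoisGroupAbove S H) :=
  haveI : TotallyDisconnectedSpace (GaloisGroupUnramifiedOutside K S) :=
    Literature.GroupTheory.ProfiniteSubquotients.totallyDisconnectedSpace_quotient
      (ramificationSubgroup K S) (ramificationSubgroup_isClosed K S)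
  inferInstance

/-- **`p·` is onto `Hⁿ(U, E_S)`** as soon as every layer class `c ∈ Hⁿ(Gal(E/F₀), 𝒪_{E,S}ˣ)` (`E ⊇ F₀` finite Galois
over `K` inside `K_S`) becomes `p` times a class after inflation to some finite Galois `E′ ⊇ E` inside `K_S`
(NSW: `Hⁿ(G_S(F₀), E_S) = lim→_E Hⁿ(Gal(E/F₀), 𝒪_{E,S}^×)`, (1.5.1)).
[cite: NeukirchSchmidtWingberg2008, VIII §3, (1.5.1), proof of (8.3.18)] [cite: SerreGaloisCohomology1997, I §2.2 Prop. 8] -/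
theorem continuousCohomology_nsmul_surjective_of_layerSupply (hHo : IsOpen (H : Set (absoluteGaloisGroup K)))
    (hNH : ramificationSubgroup K S ≤ H) (n p : ℕ)
    (h : ∀ (E : GalLayer K) (hF : baseField H ≤ E.1) (hS : ramificationSubgroup K S ≤ galFixing K E.1)
      (c : letI := algOfLE hF; groupCohomology (sUnitsRep K S ↥(baseField H) ↥E.1) n),
      ∃ (E' : GalLayer K) (hEE' : E ≤ E') (_ : ramificationSubgroup K S ≤ galFixing K E'.1)
        (z : letI := algOfLE (hF.trans hEE'); groupCohomology (sUnitsRep K S ↥(baseField H) ↥E'.1) n),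
        haveI := E.isGalois
        p • z = layerInf S hF (show E.1 ≤ E'.1 from hEE') n c)
    (y : continuousCohomology n (resRep K S H).toTopRep) :
    ∃ z : continuousCohomology n (resRep K S H).toTopRep, p • z = y := by
  haveI := compactSpace_above K S H hHo
  haveI := totallyDisconnectedSpace_above (S := S) (H := H)
  refine LayerColimit.continuousCohomology_nsmul_surjective_of_layers (resRep K S H).toTopRep
    (isDiscrete_resRep K S H) n p (fun W c => ?_) y
  change groupCohomology ((invariantsQuotFunctor ℤ (W : Subgroup ↥(galoisGroupAbove S H))).obj (resD K S H hHo)) n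
    at c
  change ∃ (V : OpenNormalSubgroup ↥(galoisGroupAbove S H)) (hVU : (V : Subgroup ↥(galoisGroupAbove S H)) ≤ W)
    (z : groupCohomology ((invariantsQuotFunctor ℤ (V : Subgroup ↥(galoisGroupAbove S H))).obj (resD K S H hHo)) n),
    p • z = stepG W V hVU (resD K S H hHo) n c
  obtain ⟨E, hF, hS, hle⟩ := exists_layerSubgroup_le S hHo hNH W
  haveI := E.isGalois
  -- push `c` to the layer `V̄_E ≤ W`, read it in `Hⁿ(Gal(E/F₀), 𝒪_{E,S}ˣ)`, apply the supply
  obtain ⟨E', hEE', hS', z, hz⟩ :=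
    h E hF hS ((layerCohomologyIso hHo E hF hS n).hom (stepG W (OpenSubgroupLayer.layerSubgroup S hHo E hF hS) hle (resD K S H hHo) n c))
  refine ⟨OpenSubgroupLayer.layerSubgroup S hHo E' (hF.trans hEE') hS', (layerSubgroup_anti S hHo hEE' hF hS').trans hle,
    (layerCohomologyIso hHo E' (hF.trans hEE') hS' n).inv z, ?_⟩
  rw [← stepG_stepG W (OpenSubgroupLayer.layerSubgroup S hHo E hF hS) hle (resD K S H hHo) n
    (OpenSubgroupLayer.layerSubgroup S hHo E' (hF.trans hEE') hS') (layerSubgroup_anti S hHo hEE' hF hS') c,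
    ← map_nsmul, hz, ← layerCohomologyIso_hom_stepG hHo hEE' hF hS' n, Iso.hom_inv_id_apply]

/-- **`Hⁿ(U, E_S)` has no `p`-torsion** as soon as every layer class `c ∈ Hⁿ(Gal(E/F₀), 𝒪_{E,S}ˣ)` with `p • c = 0`
dies after inflation to some finite Galois `E′ ⊇ E` inside `K_S`.
[cite: NeukirchSchmidtWingberg2008, VIII §3, (1.5.1), proof of (8.3.18)] [cite: SerreGaloisCohomology1997, I §2.2 Prop. 8] -/
theorem continuousCohomology_eq_zero_of_nsmul_eq_zero_of_layerSupply (hHo : IsOpen (H : Set (absoluteGaloisGroup K)))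
    (hNH : ramificationSubgroup K S ≤ H) (n p : ℕ)
    (h : ∀ (E : GalLayer K) (hF : baseField H ≤ E.1) (hS : ramificationSubgroup K S ≤ galFixing K E.1)
      (c : letI := algOfLE hF; groupCohomology (sUnitsRep K S ↥(baseField H) ↥E.1) n),
      p • c = 0 → ∃ (E' : GalLayer K) (hEE' : E ≤ E') (_ : ramificationSubgroup K S ≤ galFixing K E'.1),
        haveI := E.isGalois
        layerInf S hF (show E.1 ≤ E'.1 from hEE') n c = 0)
    (y : continuousCohomology n (resRep K S H).toTopRep) (hy : p • y = 0) : y = 0 := by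
  haveI := compactSpace_above K S H hHo
  haveI := totallyDisconnectedSpace_above (S := S) (H := H)
  refine LayerColimit.continuousCohomology_eq_zero_of_nsmul_eq_zero_of_layers (resRep K S H).toTopRep
    (isDiscrete_resRep K S H) n p (fun W c hc => ?_) y hy
  change groupCohomology ((invariantsQuotFunctor ℤ (W : Subgroup ↥(galoisGroupAbove S H))).obj (resD K S H hHo)) n
    at c
  change p • c = 0 at hc
  change ∃ (V : OpenNormalSubgroup ↥(galoisGroupAbove S H)) (hVU : (V : Subgroup ↥(galoisGroupAbove S H)) ≤ W),
    stepG W V hVU (resD K S H hHo) n c = 0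
  obtain ⟨E, hF, hS, hle⟩ := exists_layerSubgroup_le S hHo hNH W
  haveI := E.isGalois
  have hc' : p • (layerCohomologyIso hHo E hF hS n).hom
      (stepG W (OpenSubgroupLayer.layerSubgroup S hHo E hF hS) hle (resD K S H hHo) n c) = 0 := by
    rw [← map_nsmul, ← map_nsmul, hc, map_zero, map_zero]
  obtain ⟨E', hEE', hS', hz⟩ := h E hF hS _ hc'
  refine ⟨OpenSubgroupLayer.layerSubgroup S hHo E' (hF.trans hEE') hS', (layerSubgroup_anti S hHo hEE' hF hS').trans hle, ?_⟩
  rw [← stepG_stepG W (OpenSubgroupLayer.layerSubgroup S hHo E hF hS) hle (resD K S H hHo) n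
    (OpenSubgroupLayer.layerSubgroup S hHo E' (hF.trans hEE') hS') (layerSubgroup_anti S hHo hEE' hF hS') c,
    ← (layerCohomologyIso hHo E' (hF.trans hEE') hS' n).hom_inv_id_apply (stepG _ _ _ _ n _),
    layerCohomologyIso_hom_stepG hHo hEE' hF hS' n, hz, map_zero]

end Layers

end SUnits

end Literature.NumberTheory.GaloisRepresentations

end
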